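import Literature.InformationTheory.Coding.ReedMullerDuality
import Literature.InformationTheory.QuantumCodes.CSSParameters
import Literature.InformationTheory.QuantumCodes.FamilyOptimalRadius
import HarnessLib

/-!
# Quantum Reed–Muller codes: the CSS codes with `X`-checks `ℛ(a,m)` and `Z`-checks `ℛ(b,m)` are
# `[[2^m, Σ_{a<i<m−b} C(m,i), 2^{min(a,b)+1}]]` — exact parameters for every `a + b + 2 ≤ m`

Topic `Literature/InformationTheory/QuantumCodes`, namespace `Literature.InformationTheory.QuantumCodes.QRM` (venture QEC,
LADDER-QEC cell `qec`, PARTITION row 08, item «08.QRM» file 2; rung Q4 family list). File 1 is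
`Coding/ReedMullerDuality.lean` (`ReedMuller.code r m`, dimension `Σ_{i≤r} C(m,i)`, MacWilliams–Sloane Ch. 13 Thm. 4
`ℛ(r,m)^⊥ = ℛ(m−r−1,m)`); the minimum distance `2^{m−r}` of `ℛ(r,m)` is the tree's
`ReedMullerMinDistance.two_pow_le_hammingNorm` / `exists_hammingNorm_eq` (`ReedMullerBentDegree.lean`).

**The construction (in print).** Steane, *Quantum Reed–Muller codes*, IEEE Trans. IT 45 (1999) 1701 [Steane1999ReedMuller]
(arXiv:quant-ph/9608026; NOT held on this hub — acquisition request acq-13110 — and therefore not quoted) builds CSS quantum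
codes from pairs of nested Reed–Muller codes. Landahl–Cesare 2013 [LandahlCesare2013] (held, arXiv:1302.3240 §6, p. 12):
«It is straightforward to work out that the dual code to `RM(r,m)` is `RM(m−r−1,m)`. We use this to define a quantum
Reed–Muller code as a CSS code … **Definition 2.** The `r`th-order quantum binary Reed–Muller code of length `2^m`, denoted
`QRM(r,m)`, is the CSS code whose defining `X` and `Z` parity check matrices are the generator matrices for `RM(r,m)` and
its dual `RM(m−r−1,m)` respectively. Notice that in this definition … the quantum parity-check matrices are formed from
classical generator matrices». The CSS construction itself: Nielsen–Chuang §10.4.2 (`CSS(C₁,C₂)`, `C₂ ⊂ C₁`, an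
`[n, k₁ − k₂]` code correcting via `C₁` and `C₂^⊥`), the tree's `CSSCode` (`CSS.lean`).

**What is here.** The two-parameter family in exactly that form — `X` parity checks = the generator matrix of `ℛ(a,m)`
(rows = the monomials of degree `≤ a`), `Z` parity checks = the generator matrix of `ℛ(b,m)` — on the qubit set `𝔽₂^m`,
for every `a + b < m` (commutation = MacWilliams–Sloane's "product of degree `≤ m−1` has even weight"); Landahl–Cesare's
`QRM(r,m)` is the boundary case `b = m − r − 1` (a `k = 0` stabilizer state), Steane's codes are the cases `a + b ≤ m − 2`:

* `QRM.genMatrix m r` (the generator matrix of `ℛ(r,m)`), `rowSpace_genMatrix` (`= ℛ(r,m)`), `pcCode_genMatrix`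
  (`ker = ℛ(m−r−1,m)`, the duality theorem), `genMatrix_mul_transpose` (commutation);
* `QRM.code m a b h : CSSCode (Mono m a) (Mono m b) (Fin m → ZMod 2)` (`h : a + b < m`) — (definition);
* **`code_k`** `= Σ_{i ∈ [a+1, m−b)} C(m,i)`, **`code_dZ`** `= 2^{a+1}`, **`code_dX`** `= 2^{b+1}` (both sectors EXACT: the
  `Z`-logicals are `ℛ(a,m)^⊥ ∖ ℛ(b,m) = ℛ(m−a−1,m) ∖ ℛ(b,m)`, whose least weight is the minimum distance `2^{a+1}` of
  `ℛ(m−a−1,m)`, attained by a minimum-weight word that is too light to lie in `ℛ(b,m)`), for `a + b + 2 ≤ m`;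
* ★ **`code_isCode`**: `(QRM.code m a b _).IsCode (2^m) (Σ_{i ∈ [a+1,m−b)} C(m,i)) (2^{min a b + 1})` for `a + b + 2 ≤ m`;
* named members (all instances of `code_isCode`, numerals by `decide` on closed binomial sums): `iceberg_isCode`
  (`a = b = 0`: `[[2^m, 2^m − 2, 2]]`, `m ≥ 2`), `code_8_3_2` (`(m,a,b) = (3,0,1)`), `code_16_6_4` (`(4,1,1)`), `code_32_20_4`
  (`(5,1,1)`), `code_32_10_4` (`(5,1,2)`: `d_Z = 4 < d_X = 8`), `code_64_50_4` (`(6,1,1)`), `code_64_20_8` (`(6,2,2)`),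
  `code_128_70_8` (`(7,2,2)`), `code_256_70_16` (`(8,3,3)`), and the parameter identity of the `a = b = 1` class
  `code_one_one_isCode : [[2^m, 2^m − 2m − 2, 4]]` (`m ≥ 4`; the PARAMETERS of Gottesman's distance-four class
  `GottesmanDistanceFourCodes.lean` — no identification of the codes is claimed);
* Q4 (PARTITION row 08): `code_flatFin_hasOptimalRadius` — optimal Pauli-level correction radius `2^{min a b} − 1`, attained
  by sector-wise minimum-weight decoding and unbeatable by any decoder (`FamilyOptimalRadius.lean`, qubits renumbered
  `0 … 2^m − 1`).

Column words: `QRM.code` = definition (construction as printed in [LandahlCesare2013, Def. 2], attributed to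
[Steane1999ReedMuller]); every parameter statement = PROVED here (no CLAIM, no named fact). Whether each listed instance
appears in a printed table is NOT asserted (Steane's table is not held). HONEST FRAMING: exact parameters and the
information-theoretic radius only; nothing about transversal gates, magic-state distillation, decoding algorithms or
thresholds; the shortened `[[2^m − 1, 1, 3]]` codes of [AndersonDuclosCianciPoulin2014] are a different (punctured) family,
not in this file.

## References

* [Steane1999ReedMuller] A. M. Steane, *Quantum Reed–Muller codes*, IEEE Trans. Inform. Theory 45 (1999) 1701–1703,
  arXiv:quant-ph/9608026 (not held; acq-13110).
* [LandahlCesare2013] A. J. Landahl, C. Cesare, arXiv:1302.3240 (2013), §6 Def. 2 (held chunk p0012 L52–65).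
* [MacWilliamsSloane1977] F. J. MacWilliams, N. J. A. Sloane, *The Theory of Error-Correcting Codes* (1977), Ch. 13 §3
  Thms. 3–4 (held chunks p0306–p0309).
* [NielsenChuang2010] M. A. Nielsen, I. L. Chuang, *Quantum Computation and Quantum Information*, §10.4.2 (CSS codes).
* [Gottesman1997] D. Gottesman, Caltech thesis, §2.3 (distance `2t+1` corrects `t` errors) — the Q4 radius.
-/

namespace Literature.InformationTheory.QuantumCodes

open Finset Matrix Literature.InformationTheory.Coding Literature.InformationTheory.Coding.ReedMuller

namespace QRM

variable {m : ℕ}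

/-! ### The generator matrix of `ℛ(r,m)` as a check matrix -/

/-- The index set of the monomials of degree `≤ r` in `m` variables (the rows of the generator matrix of `ℛ(r,m)`).
[cite: MacWilliamsSloane1977, Ch. 13 §3 p. 373 (chunk p0306)] -/
abbrev Mono (m r : ℕ) : Type := {S : Finset (Fin m) // S.card ≤ r}

/-- **The generator matrix of `ℛ(r,m)`**: rows = the monomials of degree `≤ r`, columns = the points of `𝔽₂^m`.
[cite: MacWilliamsSloane1977, Ch. 13 §3 p. 373 (chunk p0306: the products up to degree r form a basis)] -/
def genMatrix (m r : ℕ) : Matrix (Mono m r) (Fin m → ZMod 2) (ZMod 2) :=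
  Matrix.of fun S x => monomialFun S.1 x

/-- The row space of the generator matrix is `ℛ(r,m)`. [cite: MacWilliamsSloane1977, Ch. 13 §3 p. 373 (chunk p0306)] -/
theorem rowSpace_genMatrix (m r : ℕ) : rowSpace (genMatrix m r) = ReedMuller.code r m := by
  rw [rowSpace_eq_span_rows, code_eq_span]
  rfl

/-- **The kernel of the generator matrix of `ℛ(r,m)` is `ℛ(m−r−1,m)`** (MacWilliams–Sloane Ch. 13 Thm. 4, `r + s + 1 = m`).
[cite: MacWilliamsSloane1977, Ch. 13 §3 Thm. 4 (chunks p0308–p0309)] -/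
theorem pcCode_genMatrix {r s : ℕ} (h : r + s + 1 = m) : pcCode (genMatrix m r) = ReedMuller.code s m := by
  rw [← dualCode_rowSpace, rowSpace_genMatrix, dualCode_code h]

/-- Membership in the kernel of the generator matrix of `ℛ(r,m)` is membership in `ℛ(s,m)`, `r + s + 1 = m`.
[cite: MacWilliamsSloane1977, Ch. 13 §3 Thm. 4 (chunks p0308–p0309)] -/
theorem mulVec_eq_zero_iff {r s : ℕ} (h : r + s + 1 = m) (v : (Fin m → ZMod 2) → ZMod 2) :
    genMatrix m r *ᵥ v = 0 ↔ v ∈ ReedMuller.code s m := by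
  rw [← mem_pcCode_iff, pcCode_genMatrix h]

/-- **Commutation**: the generator matrices of `ℛ(a,m)` and `ℛ(b,m)` are orthogonal for `a + b < m` (every product of a
degree-`≤ a` and a degree-`≤ b` monomial has degree `≤ m − 1`, hence even weight).
[cite: MacWilliamsSloane1977, Ch. 13 §3 Thm. 4 proof (chunk p0308)] -/
theorem genMatrix_mul_transpose {a b : ℕ} (h : a + b < m) : genMatrix m a * (genMatrix m b)ᵀ = 0 := by
  ext S T
  rw [Matrix.mul_apply, Matrix.zero_apply]
  exact ReedMuller.dotProduct_eq_zero (monomialFun_mem_code S.2) (monomialFun_mem_code T.2) h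

/-! ### The quantum Reed–Muller code `QRM(m; a, b)` -/

/-- **The quantum Reed–Muller code with `X`-checks `ℛ(a,m)` and `Z`-checks `ℛ(b,m)`** (`a + b < m`): the CSS code on the
`2^m` points of `𝔽₂^m` whose `X` parity-check matrix is the generator matrix of `ℛ(a,m)` and whose `Z` parity-check matrix
is the generator matrix of `ℛ(b,m)` (Landahl–Cesare's `QRM(r,m)` is `b = m − r − 1`; Steane's quantum Reed–Muller codes are
`a + b ≤ m − 2`). (definition)
[cite: LandahlCesare2013, §6 Def. 2 (arXiv:1302.3240 chunk p0012 L52-65)] [cite: Steane1999ReedMuller, construction (not held; acq-13110)] -/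
def code (m a b : ℕ) (h : a + b < m) : CSSCode (Mono m a) (Mono m b) (Fin m → ZMod 2) :=
  CSSCode.ofMatrices (genMatrix m a) (genMatrix m b) (genMatrix_mul_transpose h)

/-- The `X`-check matrix of `QRM(m;a,b)` is the generator matrix of `ℛ(a,m)`. [cite: LandahlCesare2013, §6 Def. 2 (chunk p0012 L58-61)] -/
theorem code_HX {a b : ℕ} (h : a + b < m) : (code m a b h).HX = genMatrix m a := rfl

/-- The `Z`-check matrix of `QRM(m;a,b)` is the generator matrix of `ℛ(b,m)`. [cite: LandahlCesare2013, §6 Def. 2 (chunk p0012 L58-61)] -/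
theorem code_HZ {a b : ℕ} (h : a + b < m) : (code m a b h).HZ = genMatrix m b := rfl

/-- **`k = Σ_{a < i < m−b} C(m,i)`**: the `X`-logicals `ker H^Z / rs H^X = ℛ(m−b−1,m) / ℛ(a,m)` have dimension
`Σ_{i ≤ m−b−1} C(m,i) − Σ_{i ≤ a} C(m,i)` (the interval `[a+1, m−b)` is honest: `m − b ≥ a + 1`).
[cite: NielsenChuang2010, §10.4.2 p. 450 (CSS(C₁,C₂) is an [n, k₁ − k₂] code)] -/
theorem code_k {a b : ℕ} (h : a + b < m) :
    (code m a b h).k = ∑ i ∈ Ico (a + 1) (m - b), m.choose i := by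
  obtain ⟨s, hs⟩ : ∃ s, b + s + 1 = m := ⟨m - b - 1, by omega⟩
  have hker : (code m a b h).kerZ = ReedMuller.code s m := pcCode_genMatrix hs
  have hrow : (code m a b h).rowSpX = ReedMuller.code a m := rowSpace_genMatrix m a
  rw [CSSCode.k, hker, hrow, finrank_code, finrank_code, range_eq_Ico, range_eq_Ico,
    ← sum_Ico_consecutive (fun i => m.choose i) (Nat.zero_le (a + 1)) (show a + 1 ≤ s + 1 by omega),
    show m - b = s + 1 by omega, Nat.add_sub_cancel_left]

/-- A word of weight `2^{s'}` with `s' < m − b'`... technical form: a nonzero word of `ℛ(b,m)` has weight `≥ 2^{m−b}`, so a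
word of weight `2^j` with `j + b < m` is not in `ℛ(b,m)` unless it is zero — and it is not zero.
[cite: MacWilliamsSloane1977, Ch. 13 §3 Thm. 3 (chunk p0308)] -/
theorem not_mem_code_of_hammingNorm_eq {b j : ℕ} (hjb : j + b < m) {v : (Fin m → ZMod 2) → ZMod 2}
    (hv : hammingNorm v = 2 ^ j) : v ∉ ReedMuller.code b m := by
  intro hmem
  have hv0 : v ≠ 0 := by
    intro h0
    rw [h0, hammingNorm_zero] at hv
    exact absurd hv.symm (pow_ne_zero j two_ne_zero)
  have hle := ReedMullerMinDistance.two_pow_le_hammingNorm m b v hmem hv0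
  rw [hv] at hle
  have hlt : 2 ^ j < 2 ^ (m - b) := Nat.pow_lt_pow_right (by norm_num) (by omega)
  omega

/-- **`d_Z = 2^{a+1}`**: the `Z`-logicals are the words of `ker H^X ∖ rs H^Z = ℛ(m−a−1,m) ∖ ℛ(b,m)`; every nonzero word
of `ℛ(m−a−1,m)` has weight `≥ 2^{a+1}` (MacWilliams–Sloane Ch. 13 Thm. 3), and a minimum-weight word of `ℛ(m−a−1,m)`
(weight `2^{a+1} < 2^{m−b}`) is not in `ℛ(b,m)`.
[cite: MacWilliamsSloane1977, Ch. 13 §3 Thms. 3-4 (chunks p0308-p0309)] -/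
theorem code_dZ {a b : ℕ} (h : a + b < m) (h2 : a + b + 2 ≤ m) : (code m a b h).dZ = 2 ^ (a + 1) := by
  obtain ⟨s, hs⟩ : ∃ s, a + s + 1 = m := ⟨m - a - 1, by omega⟩
  have hms : m - s = a + 1 := by omega
  obtain ⟨v, hvdeg, hvwt⟩ := ReedMullerMinDistance.exists_hammingNorm_eq (n := m) (r := s) (by omega)
  rw [hms] at hvwt
  have hrowZ : (code m a b h).rowSpZ = ReedMuller.code b m := rowSpace_genMatrix m b
  refine (code m a b h).dZ_eq_of_witness ((mulVec_eq_zero_iff hs v).2 hvdeg) ?_ hvwt ?_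
  · rw [hrowZ]
    exact not_mem_code_of_hammingNorm_eq (by omega) hvwt
  · intro w hw hw'
    rw [hrowZ] at hw'
    rw [code_HX, mulVec_eq_zero_iff hs] at hw
    have hw0 : w ≠ 0 := fun h0 => hw' (h0 ▸ Submodule.zero_mem _)
    have := ReedMullerMinDistance.two_pow_le_hammingNorm m s w hw hw0
    rwa [hms] at this

/-- **`d_X = 2^{b+1}`** (the `X ↔ Z` mirror of `code_dZ`: `X`-logicals `= ℛ(m−b−1,m) ∖ ℛ(a,m)`).
[cite: MacWilliamsSloane1977, Ch. 13 §3 Thms. 3-4 (chunks p0308-p0309)] -/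
theorem code_dX {a b : ℕ} (h : a + b < m) (h2 : a + b + 2 ≤ m) : (code m a b h).dX = 2 ^ (b + 1) := by
  obtain ⟨s, hs⟩ : ∃ s, b + s + 1 = m := ⟨m - b - 1, by omega⟩
  have hms : m - s = b + 1 := by omega
  obtain ⟨v, hvdeg, hvwt⟩ := ReedMullerMinDistance.exists_hammingNorm_eq (n := m) (r := s) (by omega)
  rw [hms] at hvwt
  have hrowX : (code m a b h).rowSpX = ReedMuller.code a m := rowSpace_genMatrix m a
  refine (code m a b h).dX_eq_of_witness ((mulVec_eq_zero_iff hs v).2 hvdeg) ?_ hvwt ?_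
  · rw [hrowX]
    exact not_mem_code_of_hammingNorm_eq (by omega) hvwt
  · intro w hw hw'
    rw [hrowX] at hw'
    rw [code_HZ, mulVec_eq_zero_iff hs] at hw
    have hw0 : w ≠ 0 := fun h0 => hw' (h0 ▸ Submodule.zero_mem _)
    have := ReedMullerMinDistance.two_pow_le_hammingNorm m s w hw hw0
    rwa [hms] at this

/-- `k > 0` for `a + b + 2 ≤ m` (the term `i = a + 1 < m − b` of the sum is a positive binomial coefficient).
[cite: NielsenChuang2010, §10.4.2 p. 450] -/
theorem code_k_pos {a b : ℕ} (h : a + b < m) (h2 : a + b + 2 ≤ m) : 0 < (code m a b h).k := by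
  rw [code_k]
  refine lt_of_lt_of_le (Nat.choose_pos (show a + 1 ≤ m by omega)) ?_
  exact single_le_sum (f := fun i => m.choose i) (fun _ _ => Nat.zero_le _) (mem_Ico.2 ⟨le_rfl, by omega⟩)

/-- ★ **Quantum Reed–Muller codes: exact parameters.** For `a + b + 2 ≤ m`, the CSS code with `X`-checks `ℛ(a,m)` and
`Z`-checks `ℛ(b,m)` is a `[[2^m, Σ_{a<i<m−b} C(m,i), 2^{min(a,b)+1}]]` code — `d_Z = 2^{a+1}`, `d_X = 2^{b+1}`, both exact.
(proved) [cite: Steane1999ReedMuller, construction (not held; acq-13110)] [cite: MacWilliamsSloane1977, Ch. 13 §3 Thms. 3-4 (chunks p0308-p0309)] -/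
theorem code_isCode {a b : ℕ} (h : a + b < m) (h2 : a + b + 2 ≤ m) :
    (code m a b h).IsCode (2 ^ m) (∑ i ∈ Ico (a + 1) (m - b), m.choose i) (2 ^ (min a b + 1)) := by
  have hmin : min (2 ^ (b + 1)) (2 ^ (a + 1)) = 2 ^ (min a b + 1) := by
    rcases le_total a b with hab | hab
    · rw [min_eq_right (Nat.pow_le_pow_right (by norm_num) (by omega)), min_eq_left hab]
    · rw [min_eq_left (Nat.pow_le_pow_right (by norm_num) (by omega)), min_eq_right hab]
  have := (code m a b h).isCode_of_dX_dZ (code_k_pos h h2) (code_dX h h2) (code_dZ h h2)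
  rwa [Fintype.card_fun, ZMod.card, Fintype.card_fin, code_k, hmin] at this

/-- Parameters with the numerals supplied by the caller (for the named instances below).
[cite: Steane1999ReedMuller, construction (not held; acq-13110)] -/
theorem code_isCode_of_eq {a b n k d : ℕ} (h : a + b < m) (h2 : a + b + 2 ≤ m) (hn : 2 ^ m = n)
    (hk : ∑ i ∈ Ico (a + 1) (m - b), m.choose i = k) (hd : 2 ^ (min a b + 1) = d) :
    (code m a b h).IsCode n k d := by
  rw [← hn, ← hk, ← hd]
  exact code_isCode h h2

/-! ### Named members of the family -/

/-- **The iceberg code `[[2^m, 2^m − 2, 2]]`** (`m ≥ 2`): `X`- and `Z`-checks both `ℛ(0,m) = {0, 𝟙}` (one all-`X` and one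
all-`Z` stabilizer). [cite: Steane1999ReedMuller, construction (not held; acq-13110)] -/
theorem iceberg_isCode (hm : 2 ≤ m) :
    (code m 0 0 (by omega)).IsCode (2 ^ m) (2 ^ m - 2) 2 := by
  refine code_isCode_of_eq _ (by omega) rfl ?_ (by simp)
  -- Σ_{1 ≤ i < m} C(m,i) = 2^m − 2
  have htot := Nat.sum_range_choose m
  rw [range_eq_Ico, ← sum_Ico_consecutive _ (Nat.zero_le 1) (show 1 ≤ m + 1 by omega),
    ← sum_Ico_consecutive _ (show 1 ≤ m by omega) (Nat.le_succ m), Nat.Ico_succ_singleton m, sum_singleton,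
    Nat.choose_self, show Ico 0 1 = {0} by decide, sum_singleton, Nat.choose_zero_right] at htot
  rw [zero_add, Nat.sub_zero]
  omega

/-- **`[[8, 3, 2]]`** (`m = 3`, `X`-checks `ℛ(0,3)`, `Z`-checks `ℛ(1,3)`). [cite: Steane1999ReedMuller, construction (not held; acq-13110)] -/
theorem code_8_3_2 : (code 3 0 1 (by norm_num)).IsCode 8 3 2 :=
  code_isCode_of_eq _ (by norm_num) (by norm_num) (by decide) (by norm_num)

/-- **`[[16, 6, 4]]`** (`m = 4`, both check codes `ℛ(1,4)`). [cite: Steane1999ReedMuller, construction (not held; acq-13110)] -/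
theorem code_16_6_4 : (code 4 1 1 (by norm_num)).IsCode 16 6 4 :=
  code_isCode_of_eq _ (by norm_num) (by norm_num) (by decide) (by norm_num)

/-- **`[[32, 20, 4]]`** (`m = 5`, both check codes `ℛ(1,5)`). [cite: Steane1999ReedMuller, construction (not held; acq-13110)] -/
theorem code_32_20_4 : (code 5 1 1 (by norm_num)).IsCode 32 20 4 :=
  code_isCode_of_eq _ (by norm_num) (by norm_num) (by decide) (by norm_num)

/-- **`[[32, 10, 4]]`**, asymmetric (`m = 5`, `X`-checks `ℛ(1,5)`, `Z`-checks `ℛ(2,5)`: `d_Z = 4`, `d_X = 8`).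
[cite: Steane1999ReedMuller, construction (not held; acq-13110)] -/
theorem code_32_10_4 : (code 5 1 2 (by norm_num)).IsCode 32 10 4 :=
  code_isCode_of_eq _ (by norm_num) (by norm_num) (by decide) (by norm_num)

/-- **`[[64, 50, 4]]`** (`m = 6`, both check codes `ℛ(1,6)`). [cite: Steane1999ReedMuller, construction (not held; acq-13110)] -/
theorem code_64_50_4 : (code 6 1 1 (by norm_num)).IsCode 64 50 4 :=
  code_isCode_of_eq _ (by norm_num) (by norm_num) (by decide) (by norm_num)

/-- **`[[64, 20, 8]]`** (`m = 6`, both check codes `ℛ(2,6)`). [cite: Steane1999ReedMuller, construction (not held; acq-13110)] -/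
theorem code_64_20_8 : (code 6 2 2 (by norm_num)).IsCode 64 20 8 :=
  code_isCode_of_eq _ (by norm_num) (by norm_num) (by decide) (by norm_num)

/-- **`[[128, 70, 8]]`** (`m = 7`, both check codes `ℛ(2,7)`). [cite: Steane1999ReedMuller, construction (not held; acq-13110)] -/
theorem code_128_70_8 : (code 7 2 2 (by norm_num)).IsCode 128 70 8 :=
  code_isCode_of_eq _ (by norm_num) (by norm_num) (by decide) (by norm_num)

/-- **`[[256, 70, 16]]`** (`m = 8`, both check codes `ℛ(3,8)`). [cite: Steane1999ReedMuller, construction (not held; acq-13110)] -/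
theorem code_256_70_16 : (code 8 3 3 (by norm_num)).IsCode 256 70 16 :=
  code_isCode_of_eq _ (by norm_num) (by norm_num) (by decide) (by norm_num)

/-- **The `a = b = 1` class is `[[2^m, 2^m − 2m − 2, 4]]`** (`m ≥ 4`): the PARAMETERS of Gottesman's distance-four class
(`GottesmanDistanceFourCodes.lean`); no identification of the codes is claimed here.
[cite: Steane1999ReedMuller, construction (not held; acq-13110)] -/
theorem code_one_one_isCode (hm : 4 ≤ m) :
    (code m 1 1 (by omega)).IsCode (2 ^ m) (2 ^ m - 2 * m - 2) 4 := by
  refine code_isCode_of_eq _ (by omega) rfl ?_ (by simp)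
  -- Σ_{2 ≤ i < m−1} C(m,i) = 2^m − 2m − 2
  have htot := Nat.sum_range_choose m
  rw [range_eq_Ico, ← sum_Ico_consecutive _ (Nat.zero_le 2) (show 2 ≤ m + 1 by omega),
    ← sum_Ico_consecutive _ (show 2 ≤ m - 1 by omega) (show m - 1 ≤ m + 1 by omega)] at htot
  have h01 : ∑ i ∈ Ico 0 2, m.choose i = 1 + m := by
    rw [show Ico 0 2 = {0, 1} by decide, sum_pair (by norm_num), Nat.choose_zero_right, Nat.choose_one_right]
  have htop : ∑ i ∈ Ico (m - 1) (m + 1), m.choose i = m + 1 := by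
    have hI : Ico (m - 1) m = {m - 1} := by
      rw [← Nat.Ico_succ_singleton (m - 1)]
      congr 1
      omega
    rw [sum_Ico_succ_top (show m - 1 ≤ m by omega), hI, sum_singleton, Nat.choose_self,
      Nat.choose_symm (show 1 ≤ m by omega), Nat.choose_one_right]
  rw [h01, htop] at htot
  rw [show 1 + 1 = 2 from rfl]
  omega

/-! ### Q4: the optimal correction radius -/

/-- `⌊(2^{c+1} − 1)/2⌋ = 2^c − 1`. [folklore] -/
private theorem two_pow_succ_sub_one_div_two (c : ℕ) : (2 ^ (c + 1) - 1) / 2 = 2 ^ c - 1 := by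
  have : 0 < 2 ^ c := Nat.two_pow_pos c
  rw [pow_succ]
  omega

/-- ★ **Q4 radius of the quantum Reed–Muller family** (PARTITION row 08): for `a + b + 2 ≤ m`, `QRM(m;a,b)` (qubits
renumbered `0 … 2^m − 1`) has OPTIMAL Pauli-level correction radius `2^{min(a,b)} − 1 = ⌊(d−1)/2⌋` — attained by sector-wise
minimum-weight decoding, and no decoder whatsoever corrects every Pauli error of weight `2^{min(a,b)}`.
[cite: Gottesman1997, §2.3 (chunk p0014 L3: distance 2t+1 corrects t errors)] -/
theorem code_flatFin_hasOptimalRadius {a b : ℕ} (h : a + b < m) (h2 : a + b + 2 ≤ m) :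
    (code m a b h).flatFin.HasOptimalRadius (2 ^ min a b - 1) :=
  (code_isCode h h2).flatFin_hasOptimalRadius (two_pow_succ_sub_one_div_two _)

end QRM

end Literature.InformationTheory.QuantumCodes
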